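import Literature.NumberTheory.GaloisRepresentations.ContinuousCohomologyUntwistedDescent
import Literature.NumberTheory.GaloisRepresentations.ContinuousRepCyclotomicTwistCoordinates
import Mathlib.GroupTheory.PGroup
import Mathlib.NumberTheory.Padics.PadicVal.Basic
import HarnessLib

/-!
# The prime-to-`p` base case of Tate's global Euler characteristic formula, generic form
# (Milne ADT I, proof of Thm. 5.1 — module bookkeeping)

Topic `NumberTheory/GaloisRepresentations`; namespace `Literature.NumberTheory.GaloisRepresentations`
(dot notation under `ContinuousRep`).  Theorems only; no definition, no named fact, no `sorry`, no
instance, no notation.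

Let `G` be a compact group, `W ⊴ G` open normal of finite index prime to `p`, `Δ = G ⧸ W`;
`ρ : G → Aut(A)` continuous with `A ≅ ℤ/p` (`e : ZMod p ≃+ A`, "`μ_p`") and `τ : G → Aut(M)` continuous
on a finite `𝔽_p`-module `M` (`[Module (ZMod p) M]`, basis `bv : Fin d → M`), BOTH trivial on `W`;
`a : Δ → Matrix (Fin d) (Fin d) ℤ` the matrices of the untwisted module `M′ = M ⊗ μ_p^{⊗-1}`
(`ρ.untwistRep τ W e …`, `ContinuousRepCyclotomicTwistCoordinates`) in the basis `bv` (`hσ`), acting as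
a matrix representation on `A`-valued vectors (`ha1`, `hamul`).  Write `𝓗ⁿ := Hⁿ(G, Maps(Δ, A))`
(`ρ.coindOpen W hW`, `≅ Hⁿ(W, A)` by Shapiro) with its right `Δ`-action `R_c = ρ.coindOpenHRep W hW n c`
and `Fₙ := #{h : Fin d → 𝓗ⁿ | ∀ c, (Σ_j a(c) i j • R_c (h j))ᵢ = h}` (the `Δ`-fixed vectors of
`𝓗ⁿ ⊗ M′` in coordinates).  Then:

* `natCard_continuousCohomology_eq_fixedCount`: **`#Hⁿ(G, M) = Fₙ`** (`ContinuousRepCyclotomicTwistCoordinates`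
  + `ContinuousCohomologyUntwistedDescent`);
* **`euler_characteristic_of_fixedCount`**: if `𝓗⁰, 𝓗¹, 𝓗²` are finite and the fixed-vector counts
  satisfy the "equivariant Euler characteristic identity read at `M′`"
  `v_p F₀ + v_p F₂ + r·d = v_p F₁` (the shape in which lane «TATE-EPC-TC»'s brick B6b/B8-arith delivers
  `[𝓗⁰(μ_p)] − [𝓗¹(μ_p)] + [𝓗²(μ_p)] = −r₂ [𝔽_p[Δ]]` applied to the additive function
  `X ↦ v_p #(X ⊗ M′)^Δ`), then
  **`v_p #H⁰(G, M) − v_p #H¹(G, M) + v_p #H²(G, M) + r · v_p #M = 0`** and the product form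
  `#H⁰(G, M) · #H²(G, M) · (#M)^r = #H¹(G, M)` (`euler_characteristic_of_fixedCount'`).

This is the statement `hbase` of the Artin-induction reduction (`TateEulerCharacteristicTCFiniteQuotient`,
`eulerChar_inflate_eq_zero_of_base`) for one pair `W ≤ U` (here `G := ↥U`), modulo the equivariant
identity.  Lane «TATE-EPC-TC» (cell `bsd-eis`, stmt-BirchSwinnertonDyer-19032), brick B8-alg (E-core).
HONEST FRAMING: no arithmetic is done here (the arithmetic is the hypothesis `hEuler`); no case of BSD,
of Tate's theorem, or of any conjecture is proved by this file.

## References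
* J. S. Milne, *Arithmetic Duality Theorems*, 2nd ed. (2006), I Lemma 5.4, proof of Thm. 5.1 (p. 69). [MilneADT2006]
* J. Neukirch, A. Schmidt, K. Wingberg, *Cohomology of Number Fields*, 2nd ed. (2008), (8.7.4)–(8.7.6). [NeukirchSchmidtWingberg2008]
-/

noncomputable section

open CategoryTheory Function
open scoped Topology

universe u

namespace Literature.NumberTheory.GaloisRepresentations

open _root_.TopRep _root_.ContRepresentation _root_.ContinuousCohomology

namespace ContinuousRep

section

variable {G : Type u} [Group G] [TopologicalSpace G] [IsTopologicalGroup G] [CompactSpace G]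
variable {A : Type u} [AddCommGroup A] [TopologicalSpace A] [DiscreteTopology A]
variable {M : Type u} [AddCommGroup M] [TopologicalSpace M] [DiscreteTopology M] {p : ℕ} [Fact p.Prime]
  [Module (ZMod p) M] {d : ℕ}
variable (ρ : ContinuousRep G ℤ A) (τ : ContinuousRep G ℤ M) (W : Subgroup G) [W.Normal]
  (hW : IsOpen (W : Set G)) [Fintype (G ⧸ W)] (e : ZMod p ≃+ A) (bv : Module.Basis (Fin d) (ZMod p) M)
  (hWA : ∀ w ∈ W, ∀ v : A, ρ w v = v) (hWM : ∀ w ∈ W, ∀ m : M, τ w m = m)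
  (a : G ⧸ W → Matrix (Fin d) (Fin d) ℤ)
  (ha1 : ∀ x : Fin d → A, matAct (a 1) x = x)
  (hamul : ∀ (c c' : G ⧸ W) (x : Fin d → A), matAct (a (c * c')) x = matAct (a c) (matAct (a c') x))
  (hσ : ∀ (c : G ⧸ W) (j : Fin d), ρ.untwistRep τ W e hWA hWM c (bv j) = ∑ i, a c i j • bv i)
  (hcop : ¬ p ∣ Fintype.card (G ⧸ W))

omit [TopologicalSpace G] [IsTopologicalGroup G] [CompactSpace G] [TopologicalSpace A]
  [DiscreteTopology A] [Fintype (G ⧸ W)] in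
include ha1 hamul in
/-- `a(c⁻¹)` inverts `a(c)` on vectors. [cite: MilneADT2006, I Lemma 5.4] -/
theorem matAct_inv_matAct (c : G ⧸ W) (x : Fin d → A) : matAct (a c⁻¹) (matAct (a c) x) = x := by
  rw [← hamul, inv_mul_cancel, ha1]

omit [TopologicalSpace G] [IsTopologicalGroup G] [CompactSpace G] [TopologicalSpace A]
  [DiscreteTopology A] [Fintype (G ⧸ W)] in
include ha1 hamul in
/-- `a(c)` inverts `a(c⁻¹)` on vectors. [cite: MilneADT2006, I Lemma 5.4] -/
theorem matAct_matAct_inv (c : G ⧸ W) (x : Fin d → A) : matAct (a c) (matAct (a c⁻¹) x) = x := by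
  rw [← hamul, mul_inv_cancel, ha1]

omit [TopologicalSpace A] [DiscreteTopology A] in
include e in
/-- `p` kills `A ≅ ℤ/p` (the `ℤ`-scalar form). [cite: MilneADT2006, I proof of Thm. 5.1] -/
theorem zsmul_natCast_eq_zero_of_addEquiv (v : A) : (p : ℤ) • v = 0 := by
  rw [← e.apply_symm_apply v, ← map_zsmul, zsmul_eq_mul, Int.cast_natCast, ZMod.natCast_self,
    zero_mul, map_zero]

include ha1 hamul hσ hcop in
/-- **`#Hⁿ(G, M) = Fₙ`**, the number of `Δ`-fixed vectors of `𝓗ⁿ ⊗ M′` in coordinates.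
[cite: MilneADT2006, I Lemma 5.4, proof of Thm. 5.1] -/
theorem natCard_continuousCohomology_eq_fixedCount (n : ℕ) :
    Nat.card (continuousCohomology n τ.toTopRep) =
      Nat.card {h : Fin d → continuousCohomology n (ρ.coindOpen W hW).toTopRep //
        ∀ c : G ⧸ W, (fun i => ∑ j, a c i j • ρ.coindOpenHRep W hW n c (h j)) = h} := by
  rw [ρ.natCard_continuousCohomology_eq_piTwist τ W hW e bv hWA hWM a ha1 hamul hσ n]
  exact ρ.natCard_continuousCohomology_piTwist_eq W hW a (fun c => a c⁻¹) ha1 hamul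
    (fun c x => matAct_matAct_inv W a ha1 hamul c x) (fun c x => matAct_inv_matAct W a ha1 hamul c x)
    (Fact.out : p.Prime) (fun v => zsmul_natCast_eq_zero_of_addEquiv e v) hcop n

include ha1 hamul hσ hcop e bv hWA hWM in
/-- `Hⁿ(G, M)` is finite of order `p^k`, and `Fₙ = p^k`, as soon as `𝓗ⁿ` is finite.
[cite: MilneADT2006, I proof of Thm. 5.1] -/
theorem exists_natCard_continuousCohomology_eq_pow (n : ℕ)
    (hfin : Finite (continuousCohomology n (ρ.coindOpen W hW).toTopRep)) :
    ∃ k : ℕ, Nat.card (continuousCohomology n τ.toTopRep) = p ^ k ∧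
      Nat.card {h : Fin d → continuousCohomology n (ρ.coindOpen W hW).toTopRep //
        ∀ c : G ⧸ W, (fun i => ∑ j, a c i j • ρ.coindOpenHRep W hW n c (h j)) = h} = p ^ k := by
  have hF := ρ.natCard_continuousCohomology_eq_fixedCount τ W hW e bv hWA hWM a ha1 hamul hσ hcop n
  -- `Hⁿ(G, M)` is finite: it is equinumerous with a nonempty finite set
  haveI : Nonempty {h : Fin d → continuousCohomology n (ρ.coindOpen W hW).toTopRep //
      ∀ c : G ⧸ W, (fun i => ∑ j, a c i j • ρ.coindOpenHRep W hW n c (h j)) = h} :=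
    ⟨⟨0, fun c => funext fun i => by simp only [Pi.zero_apply, map_zero, zsmul_zero, Finset.sum_const_zero]⟩⟩
  haveI : Finite (continuousCohomology n τ.toTopRep) :=
    Nat.finite_of_card_ne_zero (by rw [hF]; exact Nat.card_pos.ne')
  -- a finite abelian group killed by `p` is a `p`-group (`IsPGroup.iff_card` through `Multiplicative`;
  -- cf. `EllipticCurves.exists_natCard_eq_pow_of_nsmul_eq_zero`, not imported to keep this file generic)
  have hP : IsPGroup p (Multiplicative (continuousCohomology n τ.toTopRep)) := fun g =>
    ⟨1, by rw [pow_one, ← ofAdd_toAdd g, ← ofAdd_nsmul,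
      τ.nsmul_eq_zero_of_forall p (fun m => natCast_zsmul_eq_zero_of_module p m) n, ofAdd_zero]⟩
  obtain ⟨k, hk⟩ := IsPGroup.iff_card.mp hP
  exact ⟨k, hk, hF ▸ hk⟩

include ha1 hamul hσ hcop e bv hWA hWM in
/-- **The base case, valuation form: `v_p #H⁰(G, M) − v_p #H¹(G, M) + v_p #H²(G, M) + r · v_p #M = 0`**
given the equivariant Euler-characteristic identity read at `M′` (`hEuler`).
[cite: MilneADT2006, I proof of Thm. 5.1] [cite: NeukirchSchmidtWingberg2008, (8.7.4)] -/
theorem euler_characteristic_of_fixedCount (r : ℕ)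
    (hfin₀ : Finite (continuousCohomology 0 (ρ.coindOpen W hW).toTopRep))
    (hfin₁ : Finite (continuousCohomology 1 (ρ.coindOpen W hW).toTopRep))
    (hfin₂ : Finite (continuousCohomology 2 (ρ.coindOpen W hW).toTopRep))
    (hEuler : padicValNat p (Nat.card {h : Fin d → continuousCohomology 0 (ρ.coindOpen W hW).toTopRep //
          ∀ c : G ⧸ W, (fun i => ∑ j, a c i j • ρ.coindOpenHRep W hW 0 c (h j)) = h}) +
        padicValNat p (Nat.card {h : Fin d → continuousCohomology 2 (ρ.coindOpen W hW).toTopRep //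
          ∀ c : G ⧸ W, (fun i => ∑ j, a c i j • ρ.coindOpenHRep W hW 2 c (h j)) = h}) + r * d =
        padicValNat p (Nat.card {h : Fin d → continuousCohomology 1 (ρ.coindOpen W hW).toTopRep //
          ∀ c : G ⧸ W, (fun i => ∑ j, a c i j • ρ.coindOpenHRep W hW 1 c (h j)) = h})) :
    (padicValNat p (Nat.card (continuousCohomology 0 τ.toTopRep)) : ℤ) -
        padicValNat p (Nat.card (continuousCohomology 1 τ.toTopRep)) +
        padicValNat p (Nat.card (continuousCohomology 2 τ.toTopRep)) +
        r * padicValNat p (Nat.card M) = 0 := by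
  obtain ⟨k₀, h₀, hF₀⟩ := ρ.exists_natCard_continuousCohomology_eq_pow τ W hW e bv hWA hWM a ha1 hamul
    hσ hcop 0 hfin₀
  obtain ⟨k₁, h₁, hF₁⟩ := ρ.exists_natCard_continuousCohomology_eq_pow τ W hW e bv hWA hWM a ha1 hamul
    hσ hcop 1 hfin₁
  obtain ⟨k₂, h₂, hF₂⟩ := ρ.exists_natCard_continuousCohomology_eq_pow τ W hW e bv hWA hWM a ha1 hamul
    hσ hcop 2 hfin₂
  rw [hF₀, hF₁, hF₂, padicValNat.prime_pow, padicValNat.prime_pow, padicValNat.prime_pow] at hEuler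
  rw [h₀, h₁, h₂, (natCard_eq_pow_of_basis (A := A) e bv).1, padicValNat.prime_pow,
    padicValNat.prime_pow, padicValNat.prime_pow, padicValNat.prime_pow]
  omega

include ha1 hamul hσ hcop e bv hWA hWM in
/-- **The base case, product form: `#H⁰(G, M) · #H²(G, M) · (#M)^r = #H¹(G, M)`.**
[cite: MilneADT2006, I proof of Thm. 5.1] -/
theorem euler_characteristic_of_fixedCount' (r : ℕ)
    (hfin₀ : Finite (continuousCohomology 0 (ρ.coindOpen W hW).toTopRep))
    (hfin₁ : Finite (continuousCohomology 1 (ρ.coindOpen W hW).toTopRep))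
    (hfin₂ : Finite (continuousCohomology 2 (ρ.coindOpen W hW).toTopRep))
    (hEuler : padicValNat p (Nat.card {h : Fin d → continuousCohomology 0 (ρ.coindOpen W hW).toTopRep //
          ∀ c : G ⧸ W, (fun i => ∑ j, a c i j • ρ.coindOpenHRep W hW 0 c (h j)) = h}) +
        padicValNat p (Nat.card {h : Fin d → continuousCohomology 2 (ρ.coindOpen W hW).toTopRep //
          ∀ c : G ⧸ W, (fun i => ∑ j, a c i j • ρ.coindOpenHRep W hW 2 c (h j)) = h}) + r * d =
        padicValNat p (Nat.card {h : Fin d → continuousCohomology 1 (ρ.coindOpen W hW).toTopRep //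
          ∀ c : G ⧸ W, (fun i => ∑ j, a c i j • ρ.coindOpenHRep W hW 1 c (h j)) = h})) :
    Nat.card (continuousCohomology 0 τ.toTopRep) * Nat.card (continuousCohomology 2 τ.toTopRep) *
        Nat.card M ^ r = Nat.card (continuousCohomology 1 τ.toTopRep) := by
  obtain ⟨k₀, h₀, hF₀⟩ := ρ.exists_natCard_continuousCohomology_eq_pow τ W hW e bv hWA hWM a ha1 hamul
    hσ hcop 0 hfin₀
  obtain ⟨k₁, h₁, hF₁⟩ := ρ.exists_natCard_continuousCohomology_eq_pow τ W hW e bv hWA hWM a ha1 hamul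
    hσ hcop 1 hfin₁
  obtain ⟨k₂, h₂, hF₂⟩ := ρ.exists_natCard_continuousCohomology_eq_pow τ W hW e bv hWA hWM a ha1 hamul
    hσ hcop 2 hfin₂
  rw [hF₀, hF₁, hF₂, padicValNat.prime_pow, padicValNat.prime_pow, padicValNat.prime_pow] at hEuler
  rw [h₀, h₁, h₂, (natCard_eq_pow_of_basis (A := A) e bv).1, ← pow_mul, ← pow_add, ← pow_add, ← hEuler,
    mul_comm d r]

end

end ContinuousRep

end Literature.NumberTheory.GaloisRepresentations

end
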